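import Literature.AlgebraicGeometry.Resolution.AlterationsFibrations
import Literature.AlgebraicGeometry.Resolution.BlowupRegularPoints
import Literature.AlgebraicGeometry.Resolution.ProjectiveSpaceRegular
import HarnessLib

/-!
# De Jong's alteration theorem: Lemma 4.11 as a named fact, and 4.12 assembled from it

Topic: `Literature/AlgebraicGeometry/Resolution`. Fifth layer under `AlterationsInduction.lean`,
decomposing the named fact `DeJong1996FibrationReduction` of `AlterationsFibrations.lean`
(de Jong 1996, Lemma 4.11 with 4.12: a normal projective pair `(X, Z)` of dimension `≥ 1` over
an algebraically closed field is dominated along a generically étale alteration `φ : X' → X` by a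
pair `(X', φ⁻¹Z)` in situation (vi), `DeJong1996.SituationVI`) along the printed text:

> "4.11. Lemma. — Suppose the pair `(X, Z)` over `k` satisfies (i)–(iv). There exist a
> modification `φ : X' → X` and a morphism `f : X' → ℙ^{d-1}` of varieties having the following
> properties: (i) There exists a finite subset `S ⊂ Reg(X)`, consisting of closed points,
> disjoint from `Z`, such that `φ : X' → X` is equal to the blowing up of `X` in `S`. (ii) a) All
> fibres of `f` are equidimensional of dimension 1 and nonempty. b) The smooth locus of `f` is
> dense in all fibres of `f`. c) Let `Z' = φ⁻¹(Z)`, which we consider as a reduced closed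
> subscheme of `X'`. The morphism `f|_{Z'} : Z' → ℙ^{d-1}` is finite and étale over an open
> subscheme of `ℙ^{d-1}`. If `X` is normal, i.e. if `(X, Z)` satisfies (v), then we may choose
> `φ` and `f` such that in addition we have d) At least one fibre of `f` is smooth."

followed by 4.12 (quoted in the docstrings below): "Note that `X'` is normal also", `f` is
smooth over a non-empty open of `ℙ^{d-1}` (2.8), the Stein factorisation `X' → Y' → ℙ^{d-1}`
has `Y' → ℙ^{d-1}` finite étale ([18]), hence `Y' = ℙ^{d-1}` and all fibres of `f` are
geometrically connected, and `(X, Z)` is replaced by `(X', Z')` (4.4, 4.10).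

Here `d = dim X ≥ 1`; below the dimension is written `d + 1` and the base is `ℙ^d_k`
(`Literature.AlgebraicGeometry.Motives.projectiveSpace d k`).

* `DeJong1996.IsLemma411Fibration fX Z d φ f` — the conclusion (i), (ii) a)–c) of Lemma 4.11
  for `φ : X' → X` and a `k`-morphism `f : X' → ℙ^d_k`, on the vocabulary of
  `AlterationsFibrations.lean` (scheme-theoretic fibres `f.fiber y` at all points, Mathlib's
  smooth locus `f.smoothLocus`, `DeJong1996.IsFiniteGenericallyEtaleOn`), the blowing up being
  `IsBlowup φ 𝓘_S` (`Blowups.lean`) for the ideal sheaf `𝓘_S` of the reduced closed subscheme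
  `S` (Mathlib's `Scheme.IdealSheafData.vanishingIdeal`) and `Reg(X)` the regular locus
  `Scheme.regularLocus`. RENDERING NOTE for (ii) c): "finite and étale over an open subscheme
  of `ℙ^{d-1}`" is rendered, as the paper itself reads it — 2.11 (β) "finite étale over a
  nonempty open subset of `ℙ^d` (equivalently: `pr_p` is generically étale, see 2.6)", the proof
  of 4.11 "Assertion (ii) c) is clear as `Z' ≅ Z → π(Z) → ℙ^{d-1}` is generically étale by
  construction", and its use in 4.12 (vi) d) "finite and generically etale" — as: `f|_{Z'}` is
  finite and generically étale (2.6, `IsGenericallyEtale`), i.e. `IsFiniteGenericallyEtaleOn`.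
* `DeJong1996Lemma411` — NAMED FACT, Lemma 4.11 as printed (both sentences).
* `DeJong1996SmoothOverOpen` — NAMED FACT, the sentence of 4.12 resting on 2.8: in the
  situation of 4.12, `f` is smooth over a non-empty open of `ℙ^d`.
* `DeJong1996FibresGeometricallyConnected` — NAMED FACT, the Stein-factorisation sentences of
  4.12 (with [18] = Murre's Tata lectures on the fundamental group, i.e. SGA 1): in the
  situation of 4.12, all fibres of `f` are geometrically connected.
* PROVED: "Note that `X'` is normal also" (`IsBlowup.isIntegrallyClosed_stalk_of_finite`,
  `BlowupRegularPoints.lean`); (vi) c) "The generic fibre of `f` is smooth" from smoothness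
  over a non-empty open (`smooth_fiberToSpecResidueField_of_mem`); `𝓘_S ≠ 0`
  (`vanishingIdeal_ne_bot_of_forall_isClosed`); and the assembly
  **`DeJong1996FibrationReduction.of_lemma411`**: the three facts together with the
  projectivity of blow-ups (`BlowupProjectiveOverField`, Hartshorne II 7.16 (c)) imply
  `DeJong1996FibrationReduction` — `φ` is a generically étale alteration
  (`isAlteration_of_isBlowup`, `isGenericallyEtale_of_isBlowup`), `(X', φ⁻¹Z)` satisfies
  (iii) (blow-ups of projective varieties are projective), (iv) (4.10,
  `IsEffectiveCartier.comap_of_isDominant`), (v) (above), and `f : X' → ℙ^d` with ℙ^d an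
  integral projective `k`-scheme (`isIntegral_projectiveSpace`) satisfies (vi) a)–d).
  Consequently `DeJong1996StrongAlgClosed` from `BlowupProjectiveOverField`, the three facts and
  `DeJong1996NormalProjectiveStepVI` (4.13–4.28); `DeJong1996Strong`, `DeJong1996StrongPerfect`
  follow with `DeJong1996Descent` (4.5) by the `…of_fibration_of_stepVI` theorems of
  `AlterationsFibrations.lean`.

Deliberately NOT here: the proofs of the three facts (2.11, blowing up `π⁻¹(p)`, the
étale-local model and Bertini for 4.11; the dimension formula and 2.8 for
`DeJong1996SmoothOverOpen`; Stein factorisation — Stacks 03H0/03H2, cf.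
`Literature.AlgebraicGeometry.Morphisms.steinFactorization_geometricallyConnected` —, the
étaleness of its finite part, and `π₁(ℙ^d_k) = 1`, SGA 1 Exp. XI Prop. 1.1, for
`DeJong1996FibresGeometricallyConnected`); see the docstrings of the facts.

## Sources

* A. J. de Jong, *Smoothness, semi-stability and alterations*, Publ. Math. IHÉS 83 (1996) 51–93:
  2.5, 2.6, 2.8, 2.11 (pp. 55–56), 2.20 (p. 61), 4.4, 4.10 (pp. 66–67), Lemma 4.11 and its
  proof (pp. 67–68), 4.12 (pp. 68–69). [DeJong1996]
* A. Grothendieck, M. Raynaud, SGA 1, Exp. X Prop. 1.2, Exp. XI Prop. 1.1 [SGA1];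
  R. Hartshorne, *Algebraic Geometry*, II Prop. 7.16 (c) [Hartshorne1977].
-/

noncomputable section

open CategoryTheory CategoryTheory.Limits AlgebraicGeometry TopologicalSpace Topology

namespace Literature.AlgebraicGeometry.Resolution

universe u

open Literature.AlgebraicGeometry.Motives (projectiveSpace IsProjectiveOver)

namespace DeJong1996

/-! ## The conclusion of Lemma 4.11 -/

/-- **The conclusion (i), (ii) a)–c) of de Jong 1996, Lemma 4.11** for a pair `(X → Spec k, Z)`
of dimension `d + 1`, a morphism `φ : X' → X` and a `k`-morphism `f : X' → ℙ^d_k`: "(i) There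
exists a finite subset `S ⊂ Reg(X)`, consisting of closed points, disjoint from `Z`, such that
`φ : X' → X` is equal to the blowing up of `X` in `S`" (a blowing up along the ideal sheaf of
the reduced closed subscheme `S`, `IsBlowup`; `Reg(X)` = `Scheme.regularLocus`); "`f : X' →
ℙ^{d-1}` [a morphism] of varieties" over `k`; "(ii) a) All fibres of `f` are equidimensional of
dimension 1 and nonempty. b) The smooth locus of `f` is dense in all fibres of `f`. c) Let
`Z' = φ⁻¹(Z)`, which we consider as a reduced closed subscheme of `X'`. The morphism
`f|_{Z'} : Z' → ℙ^{d-1}` is finite and étale over an open subscheme of `ℙ^{d-1}`" — fibres,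
smooth locus (which needs `f` locally of finite presentation, automatic for varieties and
recorded as a field) and equidimensionality rendered exactly as in
`DeJong1996.IsCurveFibration`, and (ii) c) rendered as "finite and generically étale" (2.6,
2.11 (β); see the module docstring), `DeJong1996.IsFiniteGenericallyEtaleOn`.
[cite: DeJong1996, Lemma 4.11, p. 67] -/
structure IsLemma411Fibration {k : Type u} [Field k] {X : Scheme.{u}} (fX : X ⟶ Spec (.of k))
    (Z : Set X) (d : ℕ) {X' : Scheme.{u}} (φ : X' ⟶ X)
    (f : X' ⟶ (projectiveSpace d k).left) : Prop where
  /-- (i): `φ` is the blowing up of `X` in a finite set `S` of regular closed points of `X`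
  disjoint from `Z` (along the ideal sheaf of the reduced closed subscheme `S`) -/
  exists_isBlowup : ∃ (S : Set X) (hS : IsClosed S), S.Finite ∧
    (∀ s ∈ S, IsClosed ({s} : Set X)) ∧ S ⊆ Scheme.regularLocus X ∧ Disjoint S Z ∧
      IsBlowup φ (Scheme.IdealSheafData.vanishingIdeal ⟨S, hS⟩)
  /-- `f` is a morphism of `k`-varieties: `f` over `k` -/
  comp_hom : f ≫ (projectiveSpace d k).hom = φ ≫ fX
  /-- `f` is locally of finite presentation (automatic; needed to write `f.smoothLocus`) -/
  locallyOfFinitePresentation : LocallyOfFinitePresentation f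
  /-- (ii) a): all fibres of `f` are non-empty -/
  surjective : Surjective f
  /-- (ii) a): all fibres of `f` are equidimensional of dimension `1` -/
  topologicalKrullDim_eq_one : ∀ (y : ↥(projectiveSpace d k).left),
    ∀ C ∈ irreducibleComponents ↥(f.fiber y), topologicalKrullDim C = 1
  /-- (ii) b): the smooth locus of `f` is dense in every fibre -/
  dense_preimage_smoothLocus : ∀ y : ↥(projectiveSpace d k).left,
    Dense ((f.fiberι y) ⁻¹' ((@Scheme.Hom.smoothLocus X' _ f locallyOfFinitePresentation :
      X'.Opens) : Set X'))
  /-- (ii) c): `f|_{Z'} : Z' → ℙ^d` is finite and generically étale, `Z' = φ⁻¹(Z)` reduced -/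
  isFiniteGenericallyEtaleOn : IsFiniteGenericallyEtaleOn f (φ ⁻¹' Z)

end DeJong1996

/-! ## Lemma 4.11 and the two deep inputs of 4.12 as named facts -/

/-- NAMED FACT — **de Jong 1996, Lemma 4.11.** "Suppose the pair `(X, Z)` over `k` satisfies
(i)–(iv) [(i) `k` algebraically closed, (ii)/(iii) `X` (quasi-)projective — `X` a variety,
i.e. integral, with a closed `k`-immersion into some `ℙⁿ_k` —, (iv) `Z` the support of a divisor
(an effective Cartier divisor, 2.3)]. There exist a modification `φ : X' → X` and a morphism
`f : X' → ℙ^{d-1}` of varieties having the following properties: (i) There exists a finite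
subset `S ⊂ Reg(X)`, consisting of closed points, disjoint from `Z`, such that `φ : X' → X` is
equal to the blowing up of `X` in `S`. (ii) a) All fibres of `f` are equidimensional of
dimension 1 and nonempty. b) The smooth locus of `f` is dense in all fibres of `f`. c) Let
`Z' = φ⁻¹(Z)`, which we consider as a reduced closed subscheme of `X'`. The morphism
`f|_{Z'} : Z' → ℙ^{d-1}` is finite and étale over an open subscheme of `ℙ^{d-1}`. If `X` is
normal, i.e. if `(X, Z)` satisfies (v), then we may choose `φ` and `f` such that in addition we
have d) At least one fibre of `f` is smooth." Here `d = dim X ≥ 1` is written `d + 1`, the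
conclusion (i), (ii) a)–c) is `DeJong1996.IsLemma411Fibration` (see there for the rendering),
normality (v) is "all local rings are integrally closed" as in `DeJong1996.NormalProjectivePair`,
and d) reads: the fibre `f.fiber y → Spec κ(y)` at some point `y` is smooth. Inputs of the
printed proof: a finite `π : X → ℙ^d` generically étale with `π|_Z` birational onto its image
(generic linear projections, 2.11), a general point `p ∉ B ∪ π(Z)`,
`X' = {(x, ℓ) | π(x) ∈ ℓ} ⊂ X × ℙ^{d-1}` = the blowing up of `X` in `π⁻¹(p) ⊂ Reg(X)`, the
étale-local model `pr_p : ℙ^d → ℙ^{d-1}` along the exceptional fibre, and "the usual Bertini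
arguments" for d). Users take `(h : DeJong1996Lemma411)`.
[cite: DeJong1996, Lemma 4.11, pp. 67–68] -/
def DeJong1996Lemma411 : Prop :=
  ∀ (k : Type u) [Field k] [IsAlgClosed k] (X : Scheme.{u}) (fX : X ⟶ Spec (.of k)) (Z : Set X)
    (d : ℕ), IsIntegral X → IsProjectiveOver (Over.mk fX) →
      (∃ D : X.IdealSheafData, IsEffectiveCartier D ∧ (D.support : Set X) = Z) →
        topologicalKrullDim X = (d + 1 : ℕ) →
          (∃ (X' : Scheme.{u}) (φ : X' ⟶ X) (f : X' ⟶ (projectiveSpace d k).left),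
              DeJong1996.IsLemma411Fibration fX Z d φ f) ∧
            ((∀ x : X, IsIntegrallyClosed (X.presheaf.stalk x)) →
              ∃ (X' : Scheme.{u}) (φ : X' ⟶ X) (f : X' ⟶ (projectiveSpace d k).left),
                DeJong1996.IsLemma411Fibration fX Z d φ f ∧
                  ∃ y : ↥(projectiveSpace d k).left, Smooth (f.fiberToSpecResidueField y))

/-- NAMED FACT — **de Jong 1996, 4.12 (with 2.8): `f` is smooth over a non-empty open.** "4.12.
Assume (i)–(v) and apply 4.11. This gives `φ : X' → X` and `f : X' → ℙ^{d-1}`. […] We remark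
that `f`, having one nonsingular fibre and `ℙ^{d-1}` being nonsingular imply that `f` is smooth
over a nonempty open part of `ℙ^{d-1}`, see 2.8" — where 2.8 is: "Let `A → B` be a local
homomorphism of Noetherian complete local rings. Assume `A` is regular of dimension `d`, with
residue field `k`. Assume that `dim B = d + r` and that `B ⊗_A k` is formally smooth of
dimension `r` over `k`. Then `B` is formally smooth over `A`." Vendored in the situation of
4.12: `k` algebraically closed, `(X → Spec k, Z)` a normal projective pair
(`DeJong1996.NormalProjectivePair`: (iii), (iv), (v)) of dimension `d + 1`, and `φ : X' → X`,
`f : X' → ℙ^d_k` as provided by Lemma 4.11 (`DeJong1996.IsLemma411Fibration`) with d) a smooth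
fibre; conclusion: there is a non-empty open `V ⊆ ℙ^d_k` such that `f⁻¹(V) → V` is smooth.
(Behind it: `X'` is an integral variety of dimension `d + 1` and `f` is proper with all fibres
of pure dimension `1`, so at a point `x` of the smooth fibre `X'_y` one has
`dim 𝒪_{X', x} = dim 𝒪_{ℙ^d, y} + dim 𝒪_{X'_y, x}` with `𝒪_{ℙ^d, y}` and `𝒪_{X'_y, x}`
regular, whence `f` is smooth at `x`; and `f` is closed.) Users take
`(h : DeJong1996SmoothOverOpen)`. [cite: DeJong1996, 4.12 and 2.8, pp. 68 and 55] -/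
def DeJong1996SmoothOverOpen : Prop :=
  ∀ (k : Type u) [Field k] [IsAlgClosed k] (X : Scheme.{u}) (fX : X ⟶ Spec (.of k)) (Z : Set X)
    (d : ℕ) (X' : Scheme.{u}) (φ : X' ⟶ X) (f : X' ⟶ (projectiveSpace d k).left),
    DeJong1996.NormalProjectivePair fX Z → topologicalKrullDim X = (d + 1 : ℕ) →
      DeJong1996.IsLemma411Fibration fX Z d φ f →
        (∃ y : ↥(projectiveSpace d k).left, Smooth (f.fiberToSpecResidueField y)) →
          ∃ V : (projectiveSpace d k).left.Opens,
            (V : Set ↥(projectiveSpace d k).left).Nonempty ∧ Smooth (f ∣_ V)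

/-- NAMED FACT — **de Jong 1996, 4.12 (with [18]): the fibres of `f` are geometrically
connected.** "Let `X' → Y' → ℙ^{d-1}` be the Stein factorization of `f`. Note that
`Y' → ℙ^{d-1}` is (finite) étale, in view of property (ii) b) of the lemma (cf. [18]). (The
reader may circumvent this result by replacing `ℙ^{d-1}` by `Y'`.) We conclude that
`Y' = ℙ^{d-1}`, hence all fibres of `f` are geometrically connected." Vendored in the situation
of 4.12 (as in `DeJong1996SmoothOverOpen`: `k` algebraically closed, `(X, Z)` a normal
projective pair of dimension `d + 1`, `φ`, `f : X' → ℙ^d_k` as provided by Lemma 4.11 with d)),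
with conclusion Mathlib's `GeometricallyConnected f` (every base change of `f` to the spectrum
of a field is connected; equivalently all fibres are geometrically connected, Stacks 0362,
`GeometricallyConnected.iff_geometricallyConnected_fiber`). (Behind it: the finite part
`π : Y' → ℙ^d` of the Stein factorisation — Stacks 03H0; its other part has geometrically
connected fibres, `Literature.AlgebraicGeometry.Morphisms.steinFactorization_geometricallyConnected`
— is étale because `X'` is normal and every connected component of every geometric fibre of
`f` contains a smooth point of `f`, through which `f` has sections over the strict
henselisation; `Y'` is connected, and `ℙ^d` over an algebraically closed field is simply
connected (SGA 1, Exp. XI, Prop. 1.1; [18] = Murre's lectures on the fundamental group), so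
`π` is an isomorphism.) Users take `(h : DeJong1996FibresGeometricallyConnected)`.
[cite: DeJong1996, 4.12, pp. 68–69] -/
def DeJong1996FibresGeometricallyConnected : Prop :=
  ∀ (k : Type u) [Field k] [IsAlgClosed k] (X : Scheme.{u}) (fX : X ⟶ Spec (.of k)) (Z : Set X)
    (d : ℕ) (X' : Scheme.{u}) (φ : X' ⟶ X) (f : X' ⟶ (projectiveSpace d k).left),
    DeJong1996.NormalProjectivePair fX Z → topologicalKrullDim X = (d + 1 : ℕ) →
      DeJong1996.IsLemma411Fibration fX Z d φ f →
        (∃ y : ↥(projectiveSpace d k).left, Smooth (f.fiberToSpecResidueField y)) →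
          GeometricallyConnected f

/-! ## Proved ingredients of 4.12 -/

/-- A projective variety of dimension `≥ 1` has dimension `d + 1` for some `d : ℕ` (schemes of
finite type over a field are finite-dimensional,
`exists_topologicalKrullDim_le_of_locallyOfFiniteType`). [folklore] -/
theorem exists_nat_topologicalKrullDim_eq_succ {X : Scheme.{u}} {k : Type u} [Field k]
    (fX : X ⟶ Spec (.of k)) [LocallyOfFiniteType fX] [CompactSpace X]
    (h1 : 1 ≤ topologicalKrullDim X) : ∃ d : ℕ, topologicalKrullDim X = (d + 1 : ℕ) := by
  obtain ⟨n, hn⟩ := exists_topologicalKrullDim_le_of_locallyOfFiniteType fX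
  generalize topologicalKrullDim X = D at hn h1
  induction D using WithBot.recBotCoe with
  | bot => exact absurd h1 (by simp)
  | coe D =>
    induction D using ENat.recTopCoe with
    | top =>
      have : ((⊤ : ℕ∞) : WithBot ℕ∞) ≤ ((n : ℕ∞) : WithBot ℕ∞) := hn
      exact absurd (WithBot.coe_le_coe.mp this) (by simp)
    | coe m =>
      have hm : 1 ≤ m := by
        have : ((1 : ℕ∞) : WithBot ℕ∞) ≤ ((m : ℕ∞) : WithBot ℕ∞) := h1
        exact_mod_cast WithBot.coe_le_coe.mp this
      exact ⟨m - 1, by rw [Nat.sub_add_cancel hm]; rfl⟩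

/-- **(vi) c) "The generic fibre of `f` is smooth" from "`f` is smooth over a nonempty open part
of `ℙ^{d-1}`"** (de Jong 1996, 4.12): if `f⁻¹(V) → V` is smooth and `y ∈ V`, the fibre
`f.fiber y → Spec κ(y)` is smooth — it is the base change of `f⁻¹(V) → V` along
`Spec κ(y) → V` (pasting of pullback squares, `isPullback_morphismRestrict`), and smoothness is
stable under base change. [cite: DeJong1996, 4.12 (vi) c), p. 69] -/
theorem smooth_fiberToSpecResidueField_of_mem {X Y : Scheme.{u}} (f : X ⟶ Y) (V : Y.Opens)
    [Smooth (f ∣_ V)] {y : Y} (hy : y ∈ V) : Smooth (f.fiberToSpecResidueField y) := by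
  -- `Spec κ(y) → Y` factors through `V`
  have hr : Set.range (Y.fromSpecResidueField y) ⊆ Set.range V.ι := by
    rw [Scheme.range_fromSpecResidueField, Scheme.Opens.range_ι]
    exact Set.singleton_subset_iff.mpr hy
  let l := IsOpenImmersion.lift V.ι (Y.fromSpecResidueField y) hr
  have hl : l ≫ V.ι = Y.fromSpecResidueField y := IsOpenImmersion.lift_fac _ _ _
  -- the fibre embeds into `f⁻¹(V)`
  have hr' : Set.range (f.fiberι y) ⊆ Set.range (f ⁻¹ᵁ V).ι := by
    rw [Scheme.Hom.range_fiberι, Scheme.Opens.range_ι]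
    intro x hx
    change f x ∈ V
    rw [show f x = y from hx]
    exact hy
  let m := IsOpenImmersion.lift (f ⁻¹ᵁ V).ι (f.fiberι y) hr'
  have hm : m ≫ (f ⁻¹ᵁ V).ι = f.fiberι y := IsOpenImmersion.lift_fac _ _ _
  have s0 : IsPullback (f.fiberι y) (f.fiberToSpecResidueField y) f
      (Y.fromSpecResidueField y) :=
    IsPullback.of_hasPullback _ _
  have s : IsPullback (m ≫ (f ⁻¹ᵁ V).ι) (f.fiberToSpecResidueField y) f (l ≫ V.ι) := by
    rw [hm, hl]
    exact s0
  have p : m ≫ (f ∣_ V) = f.fiberToSpecResidueField y ≫ l := by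
    rw [← cancel_mono V.ι, Category.assoc, Category.assoc, morphismRestrict_ι, hl,
      ← Category.assoc, hm, Scheme.Hom.fiber_fac]
  have sq : IsPullback m (f.fiberToSpecResidueField y) (f ∣_ V) l :=
    IsPullback.of_right s p (isPullback_morphismRestrict f V).flip
  exact MorphismProperty.of_isPullback (P := @Smooth) sq inferInstance

/-- **The ideal sheaf `𝓘_S` of a finite set of closed points of a variety of dimension `≥ 1` is
non-zero** (so that the blowing up in `S` is a modification, de Jong 1996, 4.11): if `𝓘_S = 0`
then `S = X`, so the generic point of the integral scheme `X` is closed, `X` is a point, and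
`dim X = 0`. [folklore] -/
theorem vanishingIdeal_ne_bot_of_forall_isClosed {X : Scheme.{u}} [IsIntegral X]
    (h1 : 1 ≤ topologicalKrullDim X) {S : Set X} (hS : IsClosed S)
    (hSc : ∀ s ∈ S, IsClosed ({s} : Set X)) :
    Scheme.IdealSheafData.vanishingIdeal (⟨S, hS⟩ : Closeds X) ≠ ⊥ := by
  intro h
  have hsupp : S = Set.univ := by
    have := congrArg (fun I : X.IdealSheafData => ((I.support : Closeds X) : Set X)) h
    simpa using this
  have hη : IsClosed ({genericPoint X} : Set X) := hSc _ (hsupp ▸ Set.mem_univ _)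
  have huniv : ({genericPoint X} : Set X) = Set.univ := by
    rw [← hη.closure_eq]
    exact genericPoint_spec X
  haveI : Subsingleton X := ⟨fun a b => by
    have ha : a ∈ ({genericPoint X} : Set X) := huniv ▸ Set.mem_univ a
    have hb : b ∈ ({genericPoint X} : Set X) := huniv ▸ Set.mem_univ b
    rw [Set.mem_singleton_iff] at ha hb
    rw [ha, hb]⟩
  haveI : DiscreteTopology X := Subsingleton.discreteTopology
  have h0 := topologicalKrullDim_zero_of_discreteTopology X
  have h10 := h1.trans h0
  exact absurd h10 (by simp)

/-- `ℙ^d_k` is projective over `k` (the identity is a closed `k`-immersion into `ℙ^d_k`).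
[folklore] -/
theorem isProjectiveOver_projectiveSpace (d : ℕ) (k : Type u) [Field k] :
    IsProjectiveOver (Over.mk (projectiveSpace d k).hom) :=
  ⟨d, Over.homMk (𝟙 _) (Category.id_comp _),
    inferInstanceAs (IsClosedImmersion (𝟙 (projectiveSpace d k).left))⟩

/-! ## The assembly: 4.12 -/

/-- **de Jong 1996, 4.12 assembled: `DeJong1996FibrationReduction` (Lemma 4.11 with 4.12) from
Lemma 4.11 (`DeJong1996Lemma411`), its two deep inputs in 4.12 (`DeJong1996SmoothOverOpen`:
2.8; `DeJong1996FibresGeometricallyConnected`: Stein factorisation and [18]) and the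
projectivity of blow-ups (`BlowupProjectiveOverField`, Hartshorne II 7.16 (c)).** "4.12. Assume
(i)–(v) and apply 4.11. This gives `φ : X' → X` and `f : X' → ℙ^{d-1}`. Note that `X'` is
normal also. […] By replacing `(X, Z)` by `(X', Z')`, see 4.4 and 4.10, we may assume we have
(i)–(v) and the following property: (vi)". Proof: write `dim X = d + 1`
(`exists_nat_topologicalKrullDim_eq_succ`) and apply 4.11 with d). The ideal sheaf `𝓘_S` is
non-zero (`vanishingIdeal_ne_bot_of_forall_isClosed`), so `φ` is a generically étale
alteration (`isAlteration_of_isBlowup`, `isGenericallyEtale_of_isBlowup`; 4.4). The pair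
`(X', φ⁻¹Z)` satisfies (iii) (`BlowupProjectiveOverField`), (iv) (4.10,
`IsEffectiveCartier.comap_of_isDominant`) and (v) (`IsBlowup.isIntegrallyClosed_stalk_of_finite`,
the regular locus of a variety over the perfect field `k` being open,
`isOpen_regularLocus_of_locallyOfFiniteType_perfectField`). Finally `f : X' → ℙ^d_k`, with
`ℙ^d_k` an integral (`isIntegral_projectiveSpace`) projective `k`-scheme, satisfies (vi) a), b),
d) by (ii) a), b), c), is geometrically connected by `DeJong1996FibresGeometricallyConnected`,
and has smooth generic fibre (`smooth_fiberToSpecResidueField_of_mem` at the generic point of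
`ℙ^d`, which lies in the non-empty open provided by `DeJong1996SmoothOverOpen`).
[cite: DeJong1996, 4.12, pp. 68–69] -/
theorem DeJong1996FibrationReduction.of_lemma411 (hB : BlowupProjectiveOverField.{u})
    (h411 : DeJong1996Lemma411.{u}) (h28 : DeJong1996SmoothOverOpen.{u})
    (hc : DeJong1996FibresGeometricallyConnected.{u}) : DeJong1996FibrationReduction.{u} := by
  intro k _ _ X fX Z hP h1
  haveI := hP.isIntegral
  haveI := hP.isProper
  haveI : IsLocallyNoetherian X := LocallyOfFiniteType.isLocallyNoetherian fX
  haveI : CompactSpace X := QuasiCompact.compactSpace_of_compactSpace fX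
  obtain ⟨d, hd⟩ := exists_nat_topologicalKrullDim_eq_succ fX h1
  -- Lemma 4.11 with d) (`X` is normal)
  obtain ⟨X', φ, f, hF, hy⟩ := (h411 k X fX Z d inferInstance hP.isProjectiveOver
    hP.exists_isEffectiveCartier hd).2 hP.isIntegrallyClosed
  obtain ⟨S, hS, hSf, hSc, hSreg, -, hblow⟩ := hF.exists_isBlowup
  have hJ := vanishingIdeal_ne_bot_of_forall_isClosed h1 hS hSc
  have hφ : IsAlteration φ := isAlteration_of_isBlowup hblow hJ
  haveI := hφ.isIntegral
  haveI := hφ.isProper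
  haveI := hφ.isDominant
  -- 4.12: `f` is smooth over a non-empty open, and its fibres are geometrically connected
  obtain ⟨V, hVne, hVsm⟩ := h28 k X fX Z d X' φ f hP hd hF hy
  have hconn := hc k X fX Z d X' φ f hP hd hF hy
  haveI := isIntegral_projectiveSpace (n := d) (k := k)
  have hη : genericPoint (projectiveSpace d k).left ∈ V :=
    ((genericPoint_spec (projectiveSpace d k).left).mem_open_set_iff V.isOpen).mpr
      (by simpa using hVne)
  haveI := hVsm
  refine ⟨X', φ, hφ, isGenericallyEtale_of_isBlowup hblow, ?_, ?_⟩
  · -- (iii), (iv), (v) for `(X', φ⁻¹ Z)`: blow-ups are projective, 4.10, "`X'` is normal also"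
    obtain ⟨D, hD, hDZ⟩ := hP.exists_isEffectiveCartier
    exact
      { isIntegral := inferInstance
        isProjectiveOver := hB k X X' fX _ φ inferInstance hP.isProjectiveOver hJ hblow
        exists_isEffectiveCartier := ⟨D.comap φ, hD.comap_of_isDominant φ, by
          rw [Scheme.IdealSheafData.support_comap, TopologicalSpace.Closeds.coe_preimage, hDZ]⟩
        isIntegrallyClosed := fun x' => hblow.isIntegrallyClosed_stalk_of_finite
          (isOpen_regularLocus_of_locallyOfFiniteType_perfectField fX) hP.isIntegrallyClosed hS
          hSf hSc hSreg x' }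
  · -- (vi) a)–d) for `f : X' → ℙ^d`
    exact ⟨(projectiveSpace d k).left, inferInstance, (projectiveSpace d k).hom, f,
      isProjectiveOver_projectiveSpace d k, hF.comp_hom,
      { locallyOfFinitePresentation := hF.locallyOfFinitePresentation
        surjective := hF.surjective
        geometricallyConnected := hconn
        topologicalKrullDim_eq_one := hF.topologicalKrullDim_eq_one
        dense_preimage_smoothLocus := hF.dense_preimage_smoothLocus
        smooth_fiberToSpecResidueField_genericPoint :=
          smooth_fiberToSpecResidueField_of_mem f V hη },
      hF.isFiniteGenericallyEtaleOn⟩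

/-- **Thm. 4.1 with its generically-étale clause over algebraically closed fields** from the
projectivity of blow-ups (`BlowupProjectiveOverField`), Lemma 4.11 (`DeJong1996Lemma411`), the
two inputs of 4.12 (`DeJong1996SmoothOverOpen`, `DeJong1996FibresGeometricallyConnected`) and
4.13–4.28 (`DeJong1996NormalProjectiveStepVI`) — 4.3, 4.4, 4.6–4.10, 4.12 and the induction
being proved. [cite: DeJong1996, 4.3–4.12, pp. 66–69] -/
theorem DeJong1996StrongAlgClosed.of_blowupProjective_of_lemma411_of_stepVI
    (hB : BlowupProjectiveOverField.{u}) (h411 : DeJong1996Lemma411.{u})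
    (h28 : DeJong1996SmoothOverOpen.{u}) (hc : DeJong1996FibresGeometricallyConnected.{u})
    (h₂ : DeJong1996NormalProjectiveStepVI.{u}) : DeJong1996StrongAlgClosed.{u} :=
  DeJong1996StrongAlgClosed.of_blowupProjective_of_fibration_of_stepVI hB
    (DeJong1996FibrationReduction.of_lemma411 hB h411 h28 hc) h₂

end Literature.AlgebraicGeometry.Resolution

end
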